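/-
Copyright (c) 2026 the pub-hodgecm-mathlib formalisation cell (harness21).  Prover seat hodgecm-mathlib-LH4-p07 (g8), req620 Track A «(D-RAM) FOUR-FRAME» squad
(STAGE-1b pre-scoping, heir LEAD F0P3a-plan (g20∕g21) T19-24 clause; dealer LH4-plan (g12∕g13) WORD #36 «p07 (g8): row-(2) lead»), 2026-09-04.
-/
import Summits.HodgeConjecture.HodgeConjecture.Theorems.F0P3cDyRamBlockCensusOrderFormTwoTokens   -- ★ (this seat): (C1-P^{X,Y}) part 2b HEAD `ncard_fixed_selfDual_endoGL_twoToken_eq_orderForm`; brings ★ p859113, ★ p858981, ★ p858894, ★ (E1) p858757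
import Summits.HodgeConjecture.HodgeConjecture.Theorems.F0P3cDyRamBlockCensusOrderFormSquare      -- ★ p859051 (this seat): `map_sub_one_sq_mulVec`
import HarnessLib

/-!
# Crux `H413`, line LH4 «(D-RAM) FOUR-FRAME» — STAGE-1b, row (2): organ (C1-P^{a,b}) «THE JOINT (DEPTH, SQUARE) PROFILE CENSUS IN M-LETTERS» — the piece `K_{a,b}`
# `#{L ∣ SD, Γ·L = L, (Γ − 1)·L ⊆ c·L, (Γ − 1)²·L ⊆ c′·L} = Σ_{j ≤ J} [lam, (lam − 1)∕jE c, (lam − 1)²∕jE c′ ∈ 𝒪_j]·#levelSet(j, 0) + Σ_{b=1}^{R} Σ_{j ≤ J} [same]·Σᶠ_{Λ ∈ levelSetDep(j,b;(lam − jE u₀₀)∕jE c) ∩ levelSetDep(j,b;((lam − 1)² − jE (u₀₀ − 1)²)∕jE c′)} #Sol_{2b}(r_Λ)`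

Cell `hodgecm-mathlib` (D-0151), FLOOR 0, crux item H413 = `stmt-HodgeConjecture-24833`, route of record `HCCMUnconditional`; squad F0∕P3c∕LH4; lane
`--supports stmt-HodgeConjecture-24833 --as helper` (count-neutral; pays NO tier-0 row; the STAGE-1b rows `stub_rows_transvPlus ∕ transvMinus ∕ regular` stay OPEN).
THEOREMS ONLY (no `def`, no instance, no notation, no `sorry`).  Consumer: the STAGE-1b directive (heir LEAD F0P3a-plan, dealer LH4-plan), ROW (2) = TYPE-(2) POPULATION.

THE OBJECT.  ★ p858649 §5 reduces the tier-0 rows `transvMinus` ∕ `regular` to `transvPlus` ∕ `unit0` and the rows of UNLABELLED congruence-profile pieces, among them the JOINT profile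
set `K_{a,b} = {u ∈ K ∣ X ∈ ϖ^a M₃(𝒪), X² ∈ ϖ^b M₃(𝒪)}` (`X = wMatrix u − 1`; `rows(shell) ⇐ rows(K_{ℓ₀,m*}) ∧ rows(K_{ℓ₀+1,m*})`).  Its `G`-side census at `Γ = endoGL (γ₂, u)` counts
the self-dual lattices `L` with `Γ·L = L`, `(Γ − 1)·L ⊆ c·L` AND `(Γ − 1)²·L ⊆ c′·L` (`c = ϖ^a`, `c′ = ϖ^b`).  This file is the INSTANCE `X = Γ − 1`, `Y = (Γ − 1)²` of ★ (this seat)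
`ncard_fixed_selfDual_endoGL_twoToken_eq_orderForm` (part 2b): line multipliers `ξ = lam − 1`, `η = (lam − 1)²`, middle entries `X₁₁ = u₀₀ − 1`, `Y₁₁ = (u₀₀ − 1)²` (★ `endoGL_sub_one_*`,
★ `endoGL_sub_one_sq_*`, ★ (E1) `compress_endoGL_sub_one(_sq)`), and — because `|c| ≤ 1` — the FIXEDNESS cell factor `levelSetDep(j,b; lam − jE u₀₀)` is ABSORBED by the depth cell
`levelSetDep(j,b; (jE c)⁻¹(lam − jE u₀₀))` (§1, ★ p858894 `depth_mul_of_depth`), so the cells are the TWO-MULTIPLIER cells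
`levelSetDep(j,b;(jE c)⁻¹(lam − jE u₀₀)) ∩ levelSetDep(j,b;(jE c′)⁻¹((lam − 1)² − jE (u₀₀ − 1)²))` — EXACTLY LH4-p04 (g6)'s currency (★ p858876 ∕ p858944 `…ToricLevelCensusRamMTwoMult`,
`…UnrTwoMult`: two-multiplier cells = one-multiplier cells behind a lattice-free guard, per third-field type).
* §1 `map_sub_one_mulVec` (the depth token's line multiplier `lam − 1`), `levelSetDep_inter_levelSetDep_inv_mul_eq` (the shallower depth set absorbs: `levelSetDep(μ) ∩ levelSetDep(t⁻¹μ) =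
  levelSetDep(t⁻¹μ)` for `t ∈ 𝒪_j`, `t ≠ 0`).
* §2 HEAD `ncard_fixed_selfDual_endoGL_lev_sq_eq_orderForm`.  At `a = 0` (`c = 1`) the depth token is idle and this is ★ p859051's square census; at `c′ = 1` it is ★ p858894's depth census
  with an idle square token.
HONEST LABEL.  Count-neutral lattice bookkeeping over ★ organs; nothing printed is asserted; no census law is stated; `HC_CM` is proved only modulo the 7 printed citations (2 remaining
named inputs: hLiu418 = `stmt-HodgeConjecture-24832`, h413 = `stmt-HodgeConjecture-24833`) until rung 0 closes.

## References
* [Kottwitz1986BaseChangeUnits] R. E. Kottwitz, *Base change for unit elements of Hecke algebras*, Compositio Math. 60 (1986): §1 pp. 240–241.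
* [BruhatTits1972] F. Bruhat, J. Tits, *Groupes réductifs sur un corps local I*, Publ. Math. IHÉS 41 (1972): §10.
* [Jacobowitz1962] R. Jacobowitz, *Hermitian forms over local fields*, Amer. J. Math. 84 (1962): §4.
* [Flicker1998UnitaryFL] Y. Z. Flicker, *Elementary proof of the fundamental lemma for a unitary group*, Canad. J. Math. 50 (1998): p. 84 REMARK.
* [Rogawski1990] J. D. Rogawski, *Automorphic Representations of Unitary Groups in Three Variables*, Ann. of Math. Stud. 123 (1990): §4.9 Prop. 4.9.1 (a) pp. 54–55.
-/

set_option autoImplicit false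

noncomputable section

open scoped Valued WithZero Matrix MatrixGroups
open WithZero
open scoped Classical
open Literature.NumberTheory.Automorphic Literature.NumberTheory.Automorphic.HermitianLattice Literature.NumberTheory.Automorphic.UnitaryLatticeTree
open Literature.NumberTheory.Rogawski1990
open Literature.NumberTheory.Automorphic.EllipticPlaneAsFieldLine
open Literature.NumberTheory.LocalFields.QuadraticOrder
open Summit.HodgeConjecture.HodgeConjecture.Cruxes.H413.F0P3cDyRamToricCensusDefs
open Summit.HodgeConjecture.HodgeConjecture.Cruxes.H413.F0P3cDyRamWSideOrderCensus
open Summit.HodgeConjecture.HodgeConjecture.Cruxes.H413.F0P3cDyRamConeLevelTransport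
open Summit.HodgeConjecture.HodgeConjecture.Cruxes.H413.F0P3cDyRamBlockGlueCount
open Summit.HodgeConjecture.HodgeConjecture.Cruxes.H413.F0P3cDyRamBlockGluePlane
open Summit.HodgeConjecture.HodgeConjecture.Cruxes.H413.F0P3cDyRamBlockGlueLevelCount
open Summit.HodgeConjecture.HodgeConjecture.Cruxes.H413.F0P3cDyRamBlockGlueTokenCount
open Summit.HodgeConjecture.HodgeConjecture.Cruxes.H413.F0P3cDyRamBlockGlueTwoTokenCount
open Summit.HodgeConjecture.HodgeConjecture.Cruxes.H413.F0P3cDyRamBlockCensusOrderForm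
open Summit.HodgeConjecture.HodgeConjecture.Cruxes.H413.F0P3cDyRamBlockCensusOrderFormLevelAxis
open Summit.HodgeConjecture.HodgeConjecture.Cruxes.H413.F0P3cDyRamBlockCensusOrderFormLevel
open Summit.HodgeConjecture.HodgeConjecture.Cruxes.H413.F0P3cDyRamBlockCensusOrderFormToken
open Summit.HodgeConjecture.HodgeConjecture.Cruxes.H413.F0P3cDyRamBlockCensusOrderFormTwoTokensAxis
open Summit.HodgeConjecture.HodgeConjecture.Cruxes.H413.F0P3cDyRamBlockCensusOrderFormTwoTokens
open Summit.HodgeConjecture.HodgeConjecture.Cruxes.H413.F0P3cDyRamBlockCensusOrderFormSquare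

namespace Summit.HodgeConjecture.HodgeConjecture.Cruxes.H413.F0P3cDyRamBlockCensusOrderFormJointProfile

variable {E M : Type*} [Field E] [Valued E ℤᵐ⁰] [Field M] [Valued M ℤᵐ⁰] {ρ Θ : M →+* M} {α : M}

/-! ## §1 The depth token's line multiplier; the shallower depth set absorbs -/

omit [Valued E ℤᵐ⁰] [Valued M ℤᵐ⁰] in
/-- The depth token's line multiplier: `φ((γ₂ − 1)y) = (lam − 1)·φ y` for an additive `φ` with `φ(γ₂ y) = lam·φ y`. [cite: Flicker1998UnitaryFL, p. 84 REMARK] -/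
theorem map_sub_one_mulVec (φ : (Fin 2 → E) →+ M) {γ₂ : GL (Fin 2) E} {lam : M} (hφγ : ∀ x, φ ((γ₂ : Matrix (Fin 2) (Fin 2) E).mulVec x) = lam * φ x)
    (y : Fin 2 → E) :
    φ (((γ₂ : Matrix (Fin 2) (Fin 2) E) - 1) *ᵥ y) = (lam - 1) * φ y := by
  rw [Matrix.sub_mulVec, Matrix.one_mulVec, map_sub, hφγ]; ring

omit [Valued E ℤᵐ⁰] in
/-- **THE SHALLOWER DEPTH SET ABSORBS**: for `t ∈ 𝒪_j`, `t ≠ 0`: `levelSetDep(j,b; μ) ∩ levelSetDep(j,b; t⁻¹μ) = levelSetDep(j,b; t⁻¹μ)` — on a presented `Λ = x₀·𝒪_j`,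
`(t⁻¹μ)·Λ^♯ ⊆ Λ ⇒ μ·Λ^♯ = t·(t⁻¹μ)·Λ^♯ ⊆ Λ` (★ p858894 `depth_mul_of_depth`). [cite: Kottwitz1986BaseChangeUnits, §1 pp. 240–241] [cite: Jacobowitz1962, §4] -/
theorem levelSetDep_inter_levelSetDep_inv_mul_eq (hvρ : ∀ x, Valued.v (ρ x) = Valued.v x) {ϖM h : M} {j b : ℕ} {t : M}
    (ht : IsOrd ρ α (ϖM ^ j) t) (ht0 : t ≠ 0) (μ : M) :
    levelSetDep ρ Θ α ϖM h j b μ ∩ levelSetDep ρ Θ α ϖM h j b (t⁻¹ * μ) = levelSetDep ρ Θ α ϖM h j b (t⁻¹ * μ) := by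
  refine Set.inter_eq_right.2 fun Λ hΛ => ?_
  have hΛ' := hΛ
  obtain ⟨⟨x₀, hx₀, hΛx, -, -, -⟩, hdep⟩ := hΛ'
  refine ⟨hΛ.1, fun b' hb' => ?_⟩
  have key := depth_mul_of_depth (Θ := Θ) hvρ hx₀ hΛx ht hdep b' hb'
  rwa [mul_inv_cancel_left₀ ht0] at key

/-! ## §2 HEAD — the joint (depth, square) profile census in M-letters -/

/-- **(C1-P^{a,b}) THE JOINT (DEPTH, SQUARE) PROFILE CENSUS IN M-LETTERS (HEAD) — the `G`-side organ of the piece `K_{a,b}`.**  Frame of ★ (C1) p857559 (block form over `E`,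
`Γ = endoGL (γ₂, u)` UNITARY, line model `φ` with `φ(γ₂ y) = lam·φ y`, finite fixed family with tube coordinates `≤ R`, `lam ∉ 𝒪_{J+1}`, level sets finite, weights `f` = norm-residue
counts on presented cells); `c, c′ ≠ 0`, `|c| ≤ 1`, guards `|u₀₀ − 1| ≤ |c|`, `|(u₀₀ − 1)²| ≤ |c′|`.  Then
`#{L ∣ SD, Γ·L = L, L.map (Γ − 1) ≤ c·L, L.map ((Γ − 1)²) ≤ c′·L} = Σ_{j<J+1} [IsOrd_j lam ∧ IsOrd_j ((jE c)⁻¹(lam − 1)) ∧ IsOrd_j ((jE c′)⁻¹(lam − 1)²)]·#levelSet(j, 0)`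
`  + Σ_{b ∈ Icc 1 R} Σ_{j<J+1} [same]·Σᶠ_{Λ ∈ levelSetDep(j, b; (jE c)⁻¹(lam − jE u₀₀)) ∩ levelSetDep(j, b; (jE c′)⁻¹((lam − 1)² − jE (u₀₀ − 1)²))} f b j Λ`
— ★ part 2b at `X = Γ − 1`, `Y = (Γ − 1)²`, then §1 absorbs the fixedness cell.  For `K_{a,b}`: `c = ϖ^a`, `c′ = ϖ^b`.
[cite: Kottwitz1986BaseChangeUnits, §1 pp. 240–241] [cite: BruhatTits1972, §10] [cite: Jacobowitz1962, §4] [cite: Flicker1998UnitaryFL, p. 84 REMARK] [cite: Rogawski1990, §4.9 Prop. 4.9.1 (a) pp. 54–55] -/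
theorem ncard_fixed_selfDual_endoGL_lev_sq_eq_orderForm [IsPrincipalIdealRing 𝒪[E]] (σ : E →+* E) (hσ : ∀ a, σ (σ a) = a) (hvσ : ∀ a, Valued.v (σ a) = Valued.v a)
    {ϖ : E} (hϖ : Valued.v ϖ = WithZero.exp (-1 : ℤ))
    {H₂ : Matrix (Fin 2) (Fin 2) E} (hH₂ : IsUnit H₂.det) (hH₂σ : (H₂.map σ)ᵀ = H₂) {hW : E} (hhW : Valued.v hW = 1) (hhWσ : σ hW = hW) (jE : E →+* M)
    (hρρ : ∀ x, ρ (ρ x) = x) (hvρ : ∀ x, Valued.v (ρ x) = Valued.v x) (hα : ρ α ≠ α) (hα1 : Valued.v α ≤ 1)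
    (hint : ∀ z : M, Valued.v z ≤ 1 → Valued.v ((z - ρ z) / (α - ρ α)) ≤ 1)
    (hΘΘ : ∀ x, Θ (Θ x) = x) (hΘρ : ∀ x, Θ (ρ x) = ρ (Θ x)) (hvΘ : ∀ x, Valued.v (Θ x) = Valued.v x) (hΘj : ∀ x, Θ (jE x) = jE (σ x))
    (hjv : ∀ c, Valued.v (jE c) ≤ 1 ↔ Valued.v c ≤ 1) (hjfix : ∀ z, ρ z = z ↔ ∃ c, jE c = z)
    (hjpow : ∀ (t : E) (n : ℤ), Valued.v (jE t) = Valued.v (jE ϖ) ^ n ↔ Valued.v t = Valued.v ϖ ^ n)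
    (hEval : ∀ c : M, ρ c = c → c ≠ 0 → Valued.v c ≤ 1 → ∃ n : ℕ, Valued.v c = Valued.v (jE ϖ) ^ n)
    (hϖmax : ∀ t : M, ρ t = t → Valued.v t < 1 → Valued.v t ≤ Valued.v (jE ϖ))
    (φ : (Fin 2 → E) →+ M) (hφs : ∀ (c : E) (x : Fin 2 → E), φ (c • x) = jE c * φ x) (hφi : Function.Injective φ) (hφo : Function.Surjective φ)
    {γ₂ : GL (Fin 2) E} {lam h : M} (hφγ : ∀ x, φ ((γ₂ : Matrix (Fin 2) (Fin 2) E).mulVec x) = lam * φ x) (hlam : Valued.v lam = 1)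
    (hΘh : Θ h = h) (hh : h ≠ 0) (hform : ∀ x y, jE (pairing σ H₂ x y) = h * Θ (φ x) * φ y + ρ (h * Θ (φ x) * φ y))
    (u : GL (Fin 1) E) (hΓ : endoGL (γ₂, u) ∈ unitaryGroupOfForm σ (!![H₂ 0 0, 0, H₂ 0 1; 0, hW, 0; H₂ 1 0, 0, H₂ 1 1] : Matrix (Fin 3) (Fin 3) E))
    (hu : Valued.v ((u : Matrix (Fin 1) (Fin 1) E) 0 0) = 1) {c c' : E} (hc : c ≠ 0) (hc' : c' ≠ 0) (hc1 : Valued.v c ≤ 1)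
    (huc : Valued.v ((u : Matrix (Fin 1) (Fin 1) E) 0 0 - 1) ≤ Valued.v c) (huc2 : Valued.v (((u : Matrix (Fin 1) (Fin 1) E) 0 0 - 1) ^ 2) ≤ Valued.v c') {R : ℕ}
    (hfinF : {L : Submodule 𝒪[E] (Fin 3 → E) |
      IsSelfDualLattice σ ϖ (!![H₂ 0 0, 0, H₂ 0 1; 0, hW, 0; H₂ 1 0, 0, H₂ 1 1] : Matrix (Fin 3) (Fin 3) E) L ∧ mapGL (endoGL (γ₂, u)) L = L}.Finite)
    (hR : ∀ L : Submodule 𝒪[E] (Fin 3 → E), IsSelfDualLattice σ ϖ (!![H₂ 0 0, 0, H₂ 0 1; 0, hW, 0; H₂ 1 0, 0, H₂ 1 1] : Matrix (Fin 3) (Fin 3) E) L →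
      mapGL (endoGL (γ₂, u)) L = L → ∀ b : ℕ, (∀ c : E, (Pi.single 1 c : Fin 3 → E) ∈ L ↔ Valued.v c ≤ Valued.v ϖ ^ b) → b ≤ R)
    {J : ℕ} (hJ : ¬ IsOrd ρ α (jE ϖ ^ (J + 1)) lam) (hfinLS : ∀ j a, (levelSet ρ Θ α (jE ϖ) h j a).Finite)
    (f : ℕ → ℕ → AddSubgroup M → ℕ)
    (hf : ∀ (b j : ℕ) (Λ : AddSubgroup M) (x₀ : M) (r : E), 1 ≤ b → x₀ ≠ 0 →
      (∀ x, x ∈ Λ ↔ ∃ z, IsOrd ρ α (jE ϖ ^ j) z ∧ x = x₀ * z) →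
      IsOrd ρ α (jE ϖ ^ j) (dualGen ρ Θ α (jE ϖ ^ j) h x₀) → ¬ IsOrd ρ α (jE ϖ ^ j) (dualGen ρ Θ α (jE ϖ ^ j) h x₀ / jE ϖ) →
      Valued.v (dualGen ρ Θ α (jE ϖ ^ j) h x₀) = Valued.v (jE ϖ) ^ b →
      (∀ b', (∀ x ∈ Λ, Valued.v (h * Θ x * b' + ρ (h * Θ x * b')) ≤ 1) → (lam - jE ((u : Matrix (Fin 1) (Fin 1) E) 0 0)) * b' ∈ Λ) →
      IsOrd ρ α (jE ϖ ^ j) lam → jE r = glueUnit ρ Θ α (jE ϖ ^ j) h (jE ϖ) (jE hW) x₀ b →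
      f b j Λ = Nat.card {x : 𝒪[E] ⧸ 𝓂[E] ^ (2 * b) // ∃ u' : 𝒪[E], Ideal.Quotient.mk (𝓂[E] ^ (2 * b)) u' = x ∧
        Valued.v ((u' : E) * σ u' - r) ≤ Valued.v (ϖ ^ (2 * b))}) :
    {L : Submodule 𝒪[E] (Fin 3 → E) |
        IsSelfDualLattice σ ϖ (!![H₂ 0 0, 0, H₂ 0 1; 0, hW, 0; H₂ 1 0, 0, H₂ 1 1] : Matrix (Fin 3) (Fin 3) E) L ∧ mapGL (endoGL (γ₂, u)) L = L ∧
          L.map ((Matrix.toLin' (((endoGL (γ₂, u) : GL (Fin 3) E) : Matrix (Fin 3) (Fin 3) E) - 1)).restrictScalars 𝒪[E]) ≤ scaleLattice c L ∧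
          L.map ((Matrix.toLin' ((((endoGL (γ₂, u) : GL (Fin 3) E) : Matrix (Fin 3) (Fin 3) E) - 1) *
            (((endoGL (γ₂, u) : GL (Fin 3) E) : Matrix (Fin 3) (Fin 3) E) - 1))).restrictScalars 𝒪[E]) ≤ scaleLattice c' L}.ncard =
      (∑ j ∈ Finset.range (J + 1), (if IsOrd ρ α (jE ϖ ^ j) lam ∧ IsOrd ρ α (jE ϖ ^ j) ((jE c)⁻¹ * (lam - 1)) ∧
          IsOrd ρ α (jE ϖ ^ j) ((jE c')⁻¹ * ((lam - 1) * (lam - 1))) then (levelSet ρ Θ α (jE ϖ) h j 0).ncard else 0)) +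
        ∑ b ∈ Finset.Icc 1 R, ∑ j ∈ Finset.range (J + 1), (if IsOrd ρ α (jE ϖ ^ j) lam ∧ IsOrd ρ α (jE ϖ ^ j) ((jE c)⁻¹ * (lam - 1)) ∧
            IsOrd ρ α (jE ϖ ^ j) ((jE c')⁻¹ * ((lam - 1) * (lam - 1))) then
          ∑ᶠ Λ ∈ levelSetDep ρ Θ α (jE ϖ) h j b ((jE c)⁻¹ * (lam - jE ((u : Matrix (Fin 1) (Fin 1) E) 0 0))) ∩
            levelSetDep ρ Θ α (jE ϖ) h j b ((jE c')⁻¹ * ((lam - 1) * (lam - 1) - jE (((u : Matrix (Fin 1) (Fin 1) E) 0 0 - 1) ^ 2))), f b j Λ else 0) := by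
  -- the two block tokens `X = Γ − 1`, `Y = (Γ − 1)²`: shapes, middle entries, line multipliers
  have hcol := endoGL_sub_one_col γ₂ u
  have hrow := endoGL_sub_one_row γ₂ u
  have h11 := endoGL_sub_one_apply_one_one γ₂ u
  obtain ⟨hcolY, h11Y⟩ := endoGL_sub_one_sq_col γ₂ u
  have hrowY := endoGL_sub_one_sq_row γ₂ u
  have hXc : Valued.v ((((endoGL (γ₂, u) : GL (Fin 3) E) : Matrix (Fin 3) (Fin 3) E) - 1) 1 1) ≤ Valued.v c := by rw [h11]; exact huc
  have hYc : Valued.v (((((endoGL (γ₂, u) : GL (Fin 3) E) : Matrix (Fin 3) (Fin 3) E) - 1) *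
      (((endoGL (γ₂, u) : GL (Fin 3) E) : Matrix (Fin 3) (Fin 3) E) - 1)) 1 1) ≤ Valued.v c' := by rw [h11Y]; exact huc2
  have hξ : ∀ y, φ ((!![(((endoGL (γ₂, u) : GL (Fin 3) E) : Matrix (Fin 3) (Fin 3) E) - 1) 0 0, (((endoGL (γ₂, u) : GL (Fin 3) E) : Matrix (Fin 3) (Fin 3) E) - 1) 0 2;
        (((endoGL (γ₂, u) : GL (Fin 3) E) : Matrix (Fin 3) (Fin 3) E) - 1) 2 0, (((endoGL (γ₂, u) : GL (Fin 3) E) : Matrix (Fin 3) (Fin 3) E) - 1) 2 2] : Matrix (Fin 2) (Fin 2) E) *ᵥ y) =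
      (lam - 1) * φ y := fun y => by
    rw [compress_endoGL_sub_one]; exact map_sub_one_mulVec φ hφγ y
  have hη : ∀ y, φ ((!![((((endoGL (γ₂, u) : GL (Fin 3) E) : Matrix (Fin 3) (Fin 3) E) - 1) * (((endoGL (γ₂, u) : GL (Fin 3) E) : Matrix (Fin 3) (Fin 3) E) - 1)) 0 0,
          ((((endoGL (γ₂, u) : GL (Fin 3) E) : Matrix (Fin 3) (Fin 3) E) - 1) * (((endoGL (γ₂, u) : GL (Fin 3) E) : Matrix (Fin 3) (Fin 3) E) - 1)) 0 2;
        ((((endoGL (γ₂, u) : GL (Fin 3) E) : Matrix (Fin 3) (Fin 3) E) - 1) * (((endoGL (γ₂, u) : GL (Fin 3) E) : Matrix (Fin 3) (Fin 3) E) - 1)) 2 0,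
          ((((endoGL (γ₂, u) : GL (Fin 3) E) : Matrix (Fin 3) (Fin 3) E) - 1) * (((endoGL (γ₂, u) : GL (Fin 3) E) : Matrix (Fin 3) (Fin 3) E) - 1)) 2 2] : Matrix (Fin 2) (Fin 2) E) *ᵥ y) =
      (lam - 1) * (lam - 1) * φ y := fun y => by
    rw [compress_endoGL_sub_one_sq]; exact map_sub_one_sq_mulVec φ hφγ y
  have key := ncard_fixed_selfDual_endoGL_twoToken_eq_orderForm σ hσ hvσ hϖ hH₂ hH₂σ hhW hhWσ jE hρρ hvρ hα hα1 hint hΘΘ hΘρ hvΘ hΘj hjv hjfix hjpow hEval hϖmax φ hφs hφi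
    hφo hφγ hlam hΘh hh hform u hΓ hu hcol hrow hξ hcolY hrowY hη hc hc' hXc hYc hfinF hR hJ hfinLS f hf
  rw [h11, h11Y] at key
  rw [key]
  -- absorb the fixedness cell factor into the depth cell (`|c| ≤ 1`)
  have hcE0 : jE c ≠ 0 := (map_ne_zero jE).2 hc
  have ht : ∀ j, IsOrd ρ α (jE ϖ ^ j) (jE c) := fun j =>
    ⟨(hjv c).2 hc1, by rw [(hjfix _).2 ⟨c, rfl⟩, sub_self, map_zero]; exact zero_le⟩
  have hμ : lam - 1 - jE ((u : Matrix (Fin 1) (Fin 1) E) 0 0 - 1) = lam - jE ((u : Matrix (Fin 1) (Fin 1) E) 0 0) := by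
    rw [map_sub, map_one]; ring
  have hcell : ∀ j b,
      levelSetDep ρ Θ α (jE ϖ) h j b (lam - jE ((u : Matrix (Fin 1) (Fin 1) E) 0 0)) ∩
          levelSetDep ρ Θ α (jE ϖ) h j b ((jE c)⁻¹ * (lam - 1 - jE ((u : Matrix (Fin 1) (Fin 1) E) 0 0 - 1))) ∩
          levelSetDep ρ Θ α (jE ϖ) h j b ((jE c')⁻¹ * ((lam - 1) * (lam - 1) - jE (((u : Matrix (Fin 1) (Fin 1) E) 0 0 - 1) ^ 2))) =
        levelSetDep ρ Θ α (jE ϖ) h j b ((jE c)⁻¹ * (lam - jE ((u : Matrix (Fin 1) (Fin 1) E) 0 0))) ∩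
          levelSetDep ρ Θ α (jE ϖ) h j b ((jE c')⁻¹ * ((lam - 1) * (lam - 1) - jE (((u : Matrix (Fin 1) (Fin 1) E) 0 0 - 1) ^ 2))) := by
    intro j b
    rw [hμ, levelSetDep_inter_levelSetDep_inv_mul_eq (Θ := Θ) hvρ (ht j) hcE0]
  congr 1
  refine Finset.sum_congr rfl fun b _ => Finset.sum_congr rfl fun j _ => ?_
  rw [hcell j b]

end Summit.HodgeConjecture.HodgeConjecture.Cruxes.H413.F0P3cDyRamBlockCensusOrderFormJointProfile

end
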